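import Literature.MathematicalPhysics.QuantumFieldTheory.Balaban1983to89.B9Eq342GradientRowComparisonMass

/-!
# `Balaban1983to89.B9Eq342GradientRowComparisonMassUniform` — T. Bałaban, *Propagators for lattice gauge theories in a background field*, Commun. Math. Phys.
# **99** (1985) 389–434 [Balaban1985BackgroundPropagators] Thm 3.1 (3.42) p. 397 (the covariant-gradient row: constants *«dependent on d and L only»* — uniform in
# the lattice spacing) with [Balaban1984PropagatorsI] (1.29) p. 23: **THE WEIGHTED θ-SLOT OF THE GRADIENT-ROW BOOTSTRAP IS η-UNIFORM — at the physical decay rate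
# `a = κ∕t` (`t = η⁻¹ ≥ 1`) the direction constant `B_ν` of the weighted (K∇) letter `B5Eq129FreeResolventWeightedGradientRowOperator` satisfies
# `t·B_ν ≤ C_W(m, κ, L) := (1 + 2∕(L√(m∕2)))∕√(m∕2) + 4·sinh κ∕m` under the t-FREE window `4d(cosh κ − 1) ≤ m` (`L ≤ ηN_ν` the physical side), by the star-shape
# facts `t·sinh(κ∕t) ≤ sinh κ`, `t²(cosh(κ∕t) − 1) ≤ cosh κ − 1`; hence ONE t-free mass choice `√m ≥ max(√2, 2ε₁((1 + 2∕L)√2 + 4 sinh κ))` gives `t·B_ν·ε₁ ≤ 1∕2`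
# FOR EVERY LATTICE SPACING** — the weighted analogue of `B9Eq342GradientRowComparisonMass` §2's `2ε₁ ≤ √m`

statement-level skeleton of published theorems with citation tags; proofs where landed; nothing here is a claim about the Yang–Mills mass gap

CITATION HEADER (lean-in-tree rule).  Audit cell `pub-balaban`, sub-cell `t4`, BINDER row NE9; filed by NE9 crux-team LEAF PROVER 05
(`b2b-balaban-t4-ne9-formalise-leaf-05`, gen 83).  MATHEMATICS AND LEAN: t4-ne9-idea-1 (NE9 crux ideation lens 1), gen 144, content note N45
`t4/ideate/NE9/lens1-g144/N45-WEIGHTED-SLOT-ETA-UNIFORM-g144.md` and scratch kernel F `t4/ideate/NE9/lens1-g144/lean/NE9WeightedSlotUniform.lean` c7ea5641c28c3ba7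
§S∕§T∕§U∕§θ — PORTED VERBATIM but for ONE substitution: their local abbreviation `Bdir t m a n d` (a `def` of the scratch file) is WRITTEN OUT (the left-hand side of
`B9Eq342GradientRowComparisonMass.mul_weighted_row_le` at `a := κ∕t`), `mul_Bdir_le` is that tree lemma BY NAME, and `mul_Bdir_le_uniform` is named
`mul_weighted_row_le_uniform`; CREDIT THEIRS; offered for adoption in their W-g144-2 ∕ A-1 (journal 2026-08-24T20:02:23Z).  SOURCE loci: [B9] p. 397 Thm 3.1;
[B5′] p. 23 (1.29) — cites only; [folklore] one-variable calculus; nothing printed is a hypothesis.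

WHY THIS FILE (cell context).  `B9Eq342GradientRowPureGauge` §3 (the weighted junction of storey J) reads `B9Eq342GradientRowBootstrap`'s `hθ : S·ε₁ < 1` with `S = |t|` and
the bond weight `w′ b = B_{b.2}·W(b₊)`: the contraction letter is `t·B_ν·ε₁ < 1`, where `t = η⁻¹` re-enters through `B_ν`.  `B9Eq342GradientRowComparisonMass` §3 bounds
`t·B_ν` under a window still carrying `t`; this file removes every `t` at the physical rate `a = κ∕t`: the constants of the weighted closing can be fixed BEFORE `η`
(uniformity in the lattice spacing — what NE9's reading of row L13 asks of storey J), modulo the currency of `ε₁` (the consumer's).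

WHAT IS PROVED (sorry-free; 0 `def`; imports `B9Eq342GradientRowComparisonMass` (Mathlib-only) only; [folklore]).
* §1 **`sinh_mul_le_mul_sinh`** (`sinh(λx) ≤ λ sinh x`, `0 ≤ λ ≤ 1`, `x ≥ 0`), **`cosh_mul_sub_one_le`** (`cosh(λx) − 1 ≤ λ²(cosh x − 1)`), **`mul_sinh_div_le_sinh`**
  (`t·sinh(κ∕t) ≤ sinh κ`, `t ≥ 1`), **`sq_mul_cosh_div_sub_one_le`** (`t²(cosh(κ∕t) − 1) ≤ cosh κ − 1`).
* §2 **`window_of_tfree_window`** — `4d(cosh κ − 1) ≤ m ⟹ 4d·t²(cosh(κ∕t) − 1) ≤ m` for every `t ≥ 1`.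
* §3 **`mul_weighted_row_le_uniform`** — `1 ≤ t`, `0 ≤ κ`, `0 < L`, `L·t ≤ n`, `4d(cosh κ − 1) ≤ m` ⟹ `t·B_ν(t, m, κ∕t, n) ≤ C_W(m, κ, L)` (no `t` on the right).
* §4 **`weighted_theta_lt_one_uniform`** (`C_W·ε₁ < 1 ⟹ t·B_ν·ε₁ < 1` for every `t ≥ 1`); **`uniform_const_le_of_two_le`** (`m ≥ 2 ⟹ C_W ≤ ((1 + 2∕L)√2 + 4 sinh κ)∕√m`);
  **`weighted_theta_le_half_of_mass`** ∕ **`weighted_theta_lt_one_of_mass`** (`m ≥ 2`, `2ε₁((1 + 2∕L)√2 + 4 sinh κ) ≤ √m`, t-free window ⟹ `t·B_ν·ε₁ ≤ 1∕2`, `< 1`).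
HONEST SCOPE.  Real one-variable calculus; `B_ν` is the STATEMENT SHAPE of the (K∇) letter (K24) (staged, not imported); `ε₁`'s currency (the consumer's `w′`) and the
instances (REP)∕(DATA)∕(PERT) are not touched; nothing of [B9] Thm 3.1 asserted, valued or discharged; the desk's (d1) reading is the desk's.  NOT summit progress (cell
pub-balaban: NE9 NOT PRINTED ∕ NOT PROVED; «NE9 ⇐ the named binders»; row WALLED ON A MODEL (O-NE9-1; #5 UNRULED); spine PROVED 0∕9; rung (B)+1 finite T⁴ — NOT infinite
volume, NOT mass gap, NOT BetaPertH, NOT Clay).  HONEST DEPENDENCY (cell line): continuum YM on T⁴ ⇐ BetaPertH ∧ nine spine estimates (0/9 proved); BetaPertH ⇐ (D1) ∧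
(D4) ∧ CAP+tail; G-an2-4 gates asym, D1 and NE2/3/4.  NEW file; nothing modified.  Net new unproved facts: 0.
-/

namespace Literature.MathematicalPhysics.QuantumFieldTheory.Balaban1983to89.B9Eq342GradientRowComparisonMassUniform

open B9Eq342GradientRowComparisonMass (abs_mul_row_le_inv_sqrt mul_weighted_row_le)

/-! ## §1 Star-shape of `sinh` and of `cosh − 1` at the origin -/

/-- `sinh(λx) ≤ λ·sinh x` for `0 ≤ λ ≤ 1`, `0 ≤ x`: `g(y) = λ sinh y − sinh(λy)` has `g′ = λ(cosh y − cosh(λy)) ≥ 0` on all of `ℝ` (`|λy| ≤ |y|`)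
and `g(0) = 0`. [folklore]
[cite: Balaban1985BackgroundPropagators, Thm 3.1 (3.42) p.397; Balaban1984PropagatorsI, (1.29) p.23] -/
theorem sinh_mul_le_mul_sinh {l x : ℝ} (hl0 : 0 ≤ l) (hl1 : l ≤ 1) (hx : 0 ≤ x) :
    Real.sinh (l * x) ≤ l * Real.sinh x := by
  have hd : ∀ y : ℝ, HasDerivAt (fun y => l * Real.sinh y - Real.sinh (l * y))
      (l * Real.cosh y - Real.cosh (l * y) * (l * 1)) y := fun y =>
    ((Real.hasDerivAt_sinh y).const_mul l).sub (((hasDerivAt_id' y).const_mul l).sinh)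
  have hmono : Monotone (fun y => l * Real.sinh y - Real.sinh (l * y)) := by
    refine monotone_of_deriv_nonneg (fun y => (hd y).differentiableAt) (fun y => ?_)
    rw [(hd y).deriv]
    have hc : Real.cosh (l * y) ≤ Real.cosh y := by
      rw [Real.cosh_le_cosh, abs_mul, abs_of_nonneg hl0]
      exact mul_le_of_le_one_left (abs_nonneg y) hl1
    have := mul_le_mul_of_nonneg_left hc hl0
    linarith
  have h : l * Real.sinh 0 - Real.sinh (l * 0) ≤ l * Real.sinh x - Real.sinh (l * x) := hmono hx
  simp only [Real.sinh_zero, mul_zero, sub_zero] at h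
  linarith

/-- `cosh(λx) − 1 ≤ λ²(cosh x − 1)` for `0 ≤ λ ≤ 1`, `0 ≤ x`: `cosh y − 1 = 2 sinh²(y∕2)` and §S at `x∕2`. [folklore]
[cite: Balaban1985BackgroundPropagators, Thm 3.1 (3.42) p.397; Balaban1984PropagatorsI, (1.29) p.23] -/
theorem cosh_mul_sub_one_le {l x : ℝ} (hl0 : 0 ≤ l) (hl1 : l ≤ 1) (hx : 0 ≤ x) :
    Real.cosh (l * x) - 1 ≤ l ^ 2 * (Real.cosh x - 1) := by
  have key : ∀ y : ℝ, Real.cosh y - 1 = 2 * Real.sinh (y / 2) ^ 2 := by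
    intro y
    calc Real.cosh y - 1 = Real.cosh (2 * (y / 2)) - 1 := by rw [show 2 * (y / 2) = y by ring]
      _ = 2 * Real.sinh (y / 2) ^ 2 := by rw [Real.cosh_two_mul, Real.cosh_sq]; ring
  have hs : Real.sinh (l * (x / 2)) ≤ l * Real.sinh (x / 2) := sinh_mul_le_mul_sinh hl0 hl1 (by linarith)
  have hs0 : 0 ≤ Real.sinh (l * (x / 2)) := Real.sinh_nonneg_iff.2 (by positivity)
  have hsq : Real.sinh (l * (x / 2)) * Real.sinh (l * (x / 2)) ≤ (l * Real.sinh (x / 2)) * (l * Real.sinh (x / 2)) :=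
    mul_le_mul hs hs hs0 (hs0.trans hs)
  rw [key (l * x), key x, show l * x / 2 = l * (x / 2) by ring]
  calc 2 * Real.sinh (l * (x / 2)) ^ 2 = 2 * (Real.sinh (l * (x / 2)) * Real.sinh (l * (x / 2))) := by ring
    _ ≤ 2 * ((l * Real.sinh (x / 2)) * (l * Real.sinh (x / 2))) := by linarith
    _ = l ^ 2 * (2 * Real.sinh (x / 2) ^ 2) := by ring

/-- The rate form: `1 ≤ t, 0 ≤ κ ⟹ t·sinh(κ∕t) ≤ sinh κ` (`λ = 1∕t`). [folklore]
[cite: Balaban1985BackgroundPropagators, Thm 3.1 (3.42) p.397; Balaban1984PropagatorsI, (1.29) p.23] -/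
theorem mul_sinh_div_le_sinh {t κ : ℝ} (ht : 1 ≤ t) (hκ : 0 ≤ κ) : t * Real.sinh (κ / t) ≤ Real.sinh κ := by
  have ht0 : 0 < t := by linarith
  have hl1 : 1 / t ≤ 1 := by rw [div_le_one ht0]; exact ht
  have h := sinh_mul_le_mul_sinh (l := 1 / t) (x := κ) (by positivity) hl1 hκ
  rw [show 1 / t * κ = κ / t by ring] at h
  calc t * Real.sinh (κ / t) ≤ t * (1 / t * Real.sinh κ) := mul_le_mul_of_nonneg_left h ht0.le
    _ = Real.sinh κ := by rw [← mul_assoc, mul_one_div_cancel ht0.ne', one_mul]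

/-- The rate form: `1 ≤ t, 0 ≤ κ ⟹ t²(cosh(κ∕t) − 1) ≤ cosh κ − 1`. [folklore]
[cite: Balaban1985BackgroundPropagators, Thm 3.1 (3.42) p.397; Balaban1984PropagatorsI, (1.29) p.23] -/
theorem sq_mul_cosh_div_sub_one_le {t κ : ℝ} (ht : 1 ≤ t) (hκ : 0 ≤ κ) :
    t ^ 2 * (Real.cosh (κ / t) - 1) ≤ Real.cosh κ - 1 := by
  have ht0 : 0 < t := by linarith
  have hl1 : 1 / t ≤ 1 := by rw [div_le_one ht0]; exact ht
  have h := cosh_mul_sub_one_le (l := 1 / t) (x := κ) (by positivity) hl1 hκ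
  rw [show 1 / t * κ = κ / t by ring] at h
  calc t ^ 2 * (Real.cosh (κ / t) - 1) ≤ t ^ 2 * ((1 / t) ^ 2 * (Real.cosh κ - 1)) :=
        mul_le_mul_of_nonneg_left h (sq_nonneg t)
    _ = Real.cosh κ - 1 := by
        rw [one_div, inv_pow, ← mul_assoc, mul_inv_cancel₀ (pow_ne_zero 2 ht0.ne'), one_mul]

/-! ## §2 The κ-window relative to the mass becomes t-free -/

/-- `4d(cosh κ − 1) ≤ m ⟹ 4d·t²(cosh(κ∕t) − 1) ≤ m` for every `t ≥ 1`: kernel E §W's window, implied by ONE t-free window. [folklore]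
[cite: Balaban1985BackgroundPropagators, Thm 3.1 (3.42) p.397; Balaban1984PropagatorsI, (1.29) p.23] -/
theorem window_of_tfree_window {t κ m : ℝ} (ht : 1 ≤ t) (hκ : 0 ≤ κ) (d : ℕ)
    (hwin : 4 * (d : ℝ) * (Real.cosh κ - 1) ≤ m) :
    4 * (d : ℝ) * (t ^ 2 * (Real.cosh (κ / t) - 1)) ≤ m :=
  (mul_le_mul_of_nonneg_left (sq_mul_cosh_div_sub_one_le ht hκ) (by positivity)).trans hwin

/-! ## §3 The t-free letter: at the physical rate `a = κ∕t` every `t` leaves the bound (`B_ν` written out as in `B9Eq342GradientRowComparisonMass.mul_weighted_row_le`) -/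

/-- **η-UNIFORM WEIGHTED ROW GAIN.**  `1 ≤ t`, `0 ≤ κ`, `0 < L`, `L·t ≤ n` (the physical side `ηN_ν ≥ L`), t-FREE window `4d(cosh κ − 1) ≤ m` ⟹
`t·B_ν(t, m, κ∕t, n) ≤ C_W(m,κ,L) := (1 + 2∕(L√(m∕2)))∕√(m∕2) + 4 sinh κ∕m` — no `t` on the right, no `t` in the window.
Ingredients: §W at `a = κ∕t` through §T's window; `1 + e^{−κ∕t} ≤ 2`; `2t∕(n√(m∕2)) ≤ 2∕(L√(m∕2))`; `4t·sinh(κ∕t)∕m ≤ 4 sinh κ∕m` (§S). [folklore]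
[cite: Balaban1985BackgroundPropagators, Thm 3.1 (3.42) p.397; Balaban1984PropagatorsI, (1.29) p.23] -/
theorem mul_weighted_row_le_uniform (t : ℝ) (ht : 1 ≤ t) {m κ n L : ℝ} (hm : 0 < m) (hκ : 0 ≤ κ) (hL : 0 < L)
    (hLn : L * t ≤ n) (d : ℕ) (hwin : 4 * (d : ℝ) * (Real.cosh κ - 1) ≤ m) :
    t * ((1 + Real.exp (-(κ / t))) * ((1 + 2 * t / (n * Real.sqrt (m - 2 * ((d : ℝ) - 1) * t ^ 2 * (Real.cosh (κ / t) - 1)))) /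
      Real.sqrt ((m - 2 * ((d : ℝ) - 1) * t ^ 2 * (Real.cosh (κ / t) - 1)) ^ 2 +
        4 * (m - 2 * ((d : ℝ) - 1) * t ^ 2 * (Real.cosh (κ / t) - 1)) * t ^ 2)) +
    2 * Real.sinh (κ / t) / (m - 2 * (d : ℝ) * t ^ 2 * (Real.cosh (κ / t) - 1))) ≤ (1 + 2 / (L * Real.sqrt (m / 2))) / Real.sqrt (m / 2) + 4 * Real.sinh κ / m := by
  have ht0 : 0 < t := by linarith
  have hn : 0 < L * t := mul_pos hL ht0
  have hn0 : 0 < n := hn.trans_le hLn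
  have hwin' := window_of_tfree_window ht hκ d hwin
  have h := mul_weighted_row_le t ht0 hm (a := κ / t) (div_nonneg hκ ht0.le) hn0 d hwin'
  refine h.trans ?_
  have hsq2 : 0 < Real.sqrt (m / 2) := Real.sqrt_pos.2 (by linarith)
  -- `1 + e^{−κ∕t} ≤ 2`
  have hE : 1 + Real.exp (-(κ / t)) ≤ 2 := by
    have : Real.exp (-(κ / t)) ≤ 1 := Real.exp_le_one_iff.2 (neg_nonpos.2 (div_nonneg hκ ht0.le))
    linarith
  -- `2t∕(n√(m∕2)) ≤ 2∕(L√(m∕2))`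
  have hQ0 : 0 ≤ 1 + 2 * t / (n * Real.sqrt (m / 2)) := by positivity
  have hQ : 1 + 2 * t / (n * Real.sqrt (m / 2)) ≤ 1 + 2 / (L * Real.sqrt (m / 2)) := by
    have h1 : 2 * t / (n * Real.sqrt (m / 2)) ≤ 2 / (L * Real.sqrt (m / 2)) := by
      rw [div_le_div_iff₀ (by positivity) (by positivity)]
      have := mul_le_mul_of_nonneg_right hLn hsq2.le
      linarith
    linarith
  -- `4t·sinh(κ∕t)∕m ≤ 4 sinh κ∕m`
  have hS : 4 * t * Real.sinh (κ / t) / m ≤ 4 * Real.sinh κ / m := by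
    have := mul_sinh_div_le_sinh ht hκ
    exact div_le_div_of_nonneg_right (by linarith) hm.le
  -- the first term
  have hT : (1 + Real.exp (-(κ / t))) * (1 + 2 * t / (n * Real.sqrt (m / 2))) / (2 * Real.sqrt (m / 2))
      ≤ (1 + 2 / (L * Real.sqrt (m / 2))) / Real.sqrt (m / 2) := by
    rw [div_le_div_iff₀ (by positivity) hsq2]
    have h1 : (1 + Real.exp (-(κ / t))) * (1 + 2 * t / (n * Real.sqrt (m / 2))) ≤ 2 * (1 + 2 / (L * Real.sqrt (m / 2))) :=
      calc (1 + Real.exp (-(κ / t))) * (1 + 2 * t / (n * Real.sqrt (m / 2)))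
          ≤ 2 * (1 + 2 * t / (n * Real.sqrt (m / 2))) := mul_le_mul_of_nonneg_right hE hQ0
        _ ≤ 2 * (1 + 2 / (L * Real.sqrt (m / 2))) := by linarith
    calc (1 + Real.exp (-(κ / t))) * (1 + 2 * t / (n * Real.sqrt (m / 2))) * Real.sqrt (m / 2)
        ≤ 2 * (1 + 2 / (L * Real.sqrt (m / 2))) * Real.sqrt (m / 2) := mul_le_mul_of_nonneg_right h1 hsq2.le
      _ = (1 + 2 / (L * Real.sqrt (m / 2))) * (2 * Real.sqrt (m / 2)) := by ring
  exact add_le_add hT hS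

/-! ## §4 The weighted θ-slot, window-free in `η` -/

/-- **THE WEIGHTED θ-SLOT, η-UNIFORM.**  `C_W(m,κ,L)·ε₁ < 1 ⟹ t·B_ν·ε₁ < 1` for EVERY `t ≥ 1` under the t-free window — the `hθ : S·ε₁ < 1` binder of
the TREE's closing read, as (K34) §3 does, with `S = |t|` and the weight `B_ν` folded into `w′`; `ε₁` in the consumer's currency. [folklore]
[cite: Balaban1985BackgroundPropagators, Thm 3.1 (3.42) p.397; Balaban1984PropagatorsI, (1.29) p.23] -/
theorem weighted_theta_lt_one_uniform (t : ℝ) (ht : 1 ≤ t) {m κ n L ε₁ : ℝ} (hm : 0 < m) (hκ : 0 ≤ κ) (hL : 0 < L)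
    (hLn : L * t ≤ n) (d : ℕ) (hwin : 4 * (d : ℝ) * (Real.cosh κ - 1) ≤ m) (hε₁ : 0 ≤ ε₁)
    (hC : ((1 + 2 / (L * Real.sqrt (m / 2))) / Real.sqrt (m / 2) + 4 * Real.sinh κ / m) * ε₁ < 1) :
    t * ((1 + Real.exp (-(κ / t))) * ((1 + 2 * t / (n * Real.sqrt (m - 2 * ((d : ℝ) - 1) * t ^ 2 * (Real.cosh (κ / t) - 1)))) /
      Real.sqrt ((m - 2 * ((d : ℝ) - 1) * t ^ 2 * (Real.cosh (κ / t) - 1)) ^ 2 +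
        4 * (m - 2 * ((d : ℝ) - 1) * t ^ 2 * (Real.cosh (κ / t) - 1)) * t ^ 2)) +
    2 * Real.sinh (κ / t) / (m - 2 * (d : ℝ) * t ^ 2 * (Real.cosh (κ / t) - 1))) * ε₁ < 1 :=
  (mul_le_mul_of_nonneg_right (mul_weighted_row_le_uniform t ht hm hκ hL hLn d hwin) hε₁).trans_lt hC

/-- **THE CONSTANT AT MASS `m ≥ 2`.**  `C_W(m,κ,L) ≤ ((1 + 2∕L)√2 + 4 sinh κ)∕√m` (`√(m∕2) ≥ 1`, `√m ≤ m`). [folklore]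
[cite: Balaban1985BackgroundPropagators, Thm 3.1 (3.42) p.397; Balaban1984PropagatorsI, (1.29) p.23] -/
theorem uniform_const_le_of_two_le {m κ L : ℝ} (hm : 2 ≤ m) (hκ : 0 ≤ κ) (hL : 0 < L) :
    (1 + 2 / (L * Real.sqrt (m / 2))) / Real.sqrt (m / 2) + 4 * Real.sinh κ / m
      ≤ ((1 + 2 / L) * Real.sqrt 2 + 4 * Real.sinh κ) / Real.sqrt m := by
  have hm0 : 0 < m := by linarith
  have hsm : 0 < Real.sqrt m := Real.sqrt_pos.2 hm0
  have hone : 1 ≤ Real.sqrt (m / 2) := by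
    have h := Real.sqrt_le_sqrt (show (1:ℝ) ≤ m / 2 by linarith)
    rwa [Real.sqrt_one] at h
  have hsq2pos : 0 < Real.sqrt (m / 2) := by linarith
  have hsplit : Real.sqrt (m / 2) = Real.sqrt m / Real.sqrt 2 := Real.sqrt_div' m (by norm_num)
  -- first term
  have h1 : (1 + 2 / (L * Real.sqrt (m / 2))) / Real.sqrt (m / 2) ≤ (1 + 2 / L) * Real.sqrt 2 / Real.sqrt m := by
    have hA : 2 / (L * Real.sqrt (m / 2)) ≤ 2 / L := by
      apply div_le_div_of_nonneg_left (by norm_num) hL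
      calc L = L * 1 := (mul_one L).symm
        _ ≤ L * Real.sqrt (m / 2) := mul_le_mul_of_nonneg_left hone hL.le
    have hB : (1 + 2 / (L * Real.sqrt (m / 2))) / Real.sqrt (m / 2) ≤ (1 + 2 / L) / Real.sqrt (m / 2) :=
      div_le_div_of_nonneg_right (by linarith) hsq2pos.le
    have hC : (1 + 2 / L) / Real.sqrt (m / 2) = (1 + 2 / L) * Real.sqrt 2 / Real.sqrt m := by
      rw [hsplit, div_div_eq_mul_div]
    rw [← hC]; exact hB
  -- second term
  have h2 : 4 * Real.sinh κ / m ≤ 4 * Real.sinh κ / Real.sqrt m := by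
    have hsinh : 0 ≤ Real.sinh κ := Real.sinh_nonneg_iff.2 hκ
    apply div_le_div_of_nonneg_left (by positivity) hsm
    have h1m : 1 ≤ Real.sqrt m := by
      have h := Real.sqrt_le_sqrt (show (1:ℝ) ≤ m by linarith)
      rwa [Real.sqrt_one] at h
    calc Real.sqrt m = Real.sqrt m * 1 := (mul_one _).symm
      _ ≤ Real.sqrt m * Real.sqrt m := mul_le_mul_of_nonneg_left h1m hsm.le
      _ = m := Real.mul_self_sqrt hm0.le
  calc (1 + 2 / (L * Real.sqrt (m / 2))) / Real.sqrt (m / 2) + 4 * Real.sinh κ / m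
      ≤ (1 + 2 / L) * Real.sqrt 2 / Real.sqrt m + 4 * Real.sinh κ / Real.sqrt m := add_le_add h1 h2
    _ = ((1 + 2 / L) * Real.sqrt 2 + 4 * Real.sinh κ) / Real.sqrt m := by ring

/-- **ONE t-FREE MASS CHOICE CLOSES THE WEIGHTED SLOT FOR EVERY `η`.**  `m ≥ 2`, `2ε₁((1 + 2∕L)√2 + 4 sinh κ) ≤ √m`, t-free window
`4d(cosh κ − 1) ≤ m` ⟹ `t·B_ν·ε₁ ≤ 1∕2` for every `t ≥ 1` (every lattice spacing `η = t⁻¹ ≤ 1`) — the weighted analogue of kernel E §θ's `2ε₁ ≤ √m`.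
[folklore]
[cite: Balaban1985BackgroundPropagators, Thm 3.1 (3.42) p.397; Balaban1984PropagatorsI, (1.29) p.23] -/
theorem weighted_theta_le_half_of_mass (t : ℝ) (ht : 1 ≤ t) {m κ n L ε₁ : ℝ} (hm : 2 ≤ m) (hκ : 0 ≤ κ) (hL : 0 < L)
    (hLn : L * t ≤ n) (d : ℕ) (hwin : 4 * (d : ℝ) * (Real.cosh κ - 1) ≤ m) (hε₁ : 0 ≤ ε₁)
    (hmε : 2 * ε₁ * ((1 + 2 / L) * Real.sqrt 2 + 4 * Real.sinh κ) ≤ Real.sqrt m) :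
    t * ((1 + Real.exp (-(κ / t))) * ((1 + 2 * t / (n * Real.sqrt (m - 2 * ((d : ℝ) - 1) * t ^ 2 * (Real.cosh (κ / t) - 1)))) /
      Real.sqrt ((m - 2 * ((d : ℝ) - 1) * t ^ 2 * (Real.cosh (κ / t) - 1)) ^ 2 +
        4 * (m - 2 * ((d : ℝ) - 1) * t ^ 2 * (Real.cosh (κ / t) - 1)) * t ^ 2)) +
    2 * Real.sinh (κ / t) / (m - 2 * (d : ℝ) * t ^ 2 * (Real.cosh (κ / t) - 1))) * ε₁ ≤ 1 / 2 := by
  have hm0 : 0 < m := by linarith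
  have hsm : 0 < Real.sqrt m := Real.sqrt_pos.2 hm0
  have hB := mul_weighted_row_le_uniform t ht hm0 hκ hL hLn d hwin
  have hK := uniform_const_le_of_two_le hm hκ hL
  calc t * ((1 + Real.exp (-(κ / t))) * ((1 + 2 * t / (n * Real.sqrt (m - 2 * ((d : ℝ) - 1) * t ^ 2 * (Real.cosh (κ / t) - 1)))) /
      Real.sqrt ((m - 2 * ((d : ℝ) - 1) * t ^ 2 * (Real.cosh (κ / t) - 1)) ^ 2 +
        4 * (m - 2 * ((d : ℝ) - 1) * t ^ 2 * (Real.cosh (κ / t) - 1)) * t ^ 2)) +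
    2 * Real.sinh (κ / t) / (m - 2 * (d : ℝ) * t ^ 2 * (Real.cosh (κ / t) - 1))) * ε₁
      ≤ ((1 + 2 / (L * Real.sqrt (m / 2))) / Real.sqrt (m / 2) + 4 * Real.sinh κ / m) * ε₁ := mul_le_mul_of_nonneg_right hB hε₁
    _ ≤ ((1 + 2 / L) * Real.sqrt 2 + 4 * Real.sinh κ) / Real.sqrt m * ε₁ := mul_le_mul_of_nonneg_right hK hε₁
    _ ≤ 1 / 2 := by
        rw [div_mul_eq_mul_div, div_le_iff₀ hsm]
        linarith

/-- The strict form for the TREE's `hθ` binder under the same mass choice. [folklore]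
[cite: Balaban1985BackgroundPropagators, Thm 3.1 (3.42) p.397; Balaban1984PropagatorsI, (1.29) p.23] -/
theorem weighted_theta_lt_one_of_mass (t : ℝ) (ht : 1 ≤ t) {m κ n L ε₁ : ℝ} (hm : 2 ≤ m) (hκ : 0 ≤ κ) (hL : 0 < L)
    (hLn : L * t ≤ n) (d : ℕ) (hwin : 4 * (d : ℝ) * (Real.cosh κ - 1) ≤ m) (hε₁ : 0 ≤ ε₁)
    (hmε : 2 * ε₁ * ((1 + 2 / L) * Real.sqrt 2 + 4 * Real.sinh κ) ≤ Real.sqrt m) :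
    t * ((1 + Real.exp (-(κ / t))) * ((1 + 2 * t / (n * Real.sqrt (m - 2 * ((d : ℝ) - 1) * t ^ 2 * (Real.cosh (κ / t) - 1)))) /
      Real.sqrt ((m - 2 * ((d : ℝ) - 1) * t ^ 2 * (Real.cosh (κ / t) - 1)) ^ 2 +
        4 * (m - 2 * ((d : ℝ) - 1) * t ^ 2 * (Real.cosh (κ / t) - 1)) * t ^ 2)) +
    2 * Real.sinh (κ / t) / (m - 2 * (d : ℝ) * t ^ 2 * (Real.cosh (κ / t) - 1))) * ε₁ < 1 :=
  (weighted_theta_le_half_of_mass t ht hm hκ hL hLn d hwin hε₁ hmε).trans_lt (by norm_num)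

end Literature.MathematicalPhysics.QuantumFieldTheory.Balaban1983to89.B9Eq342GradientRowComparisonMassUniform
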